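import Literature.NumberTheory.Automorphic.UnitaryGroupBorelPair
import Literature.NumberTheory.Automorphic.AdelicVectorHeightGalois
import HarnessLib

/-!
# The Borel height on the quasi-split unitary group `U(J_N)` (letters for the trace formula of the
# quasi-split group, III a)

Topic `NumberTheory/Automorphic`; namespace `Literature.NumberTheory.Automorphic.UnitaryGroup`.
DEFINITIONS with bodies + proved structure lemmas; no named fact, no `sorry`, no instance, no
notation. Setting: Mok's `U_{E/F}(N) = U(J_N)` (`UnitaryGroup.quasiSplit F E c N`), its standard
Borel pair `B(𝔸_F) = N(𝔸_F) · T(𝔸_F)` (`borelAdelic`, `adelicUnipotent`, `torusAdelic` of letters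
I–II, `UnitaryGroupBorelPair`, `UnitaryGroupConstantTerm`).

* `lastRow g = e_N · g ∈ 𝔸_E^N` (the last row of the matrix of `g ∈ U(J_N)(𝔸_F) ≤ GL_N(𝔸_E)`) and
  the **Borel height** `borelHeight g = h(e_N · g)⁻¹ ∈ ℝ≥0`, `h = vecHeight` the height of adelic
  row vectors (Godement; Garrett (2018), §2.2: `η(g) = |det g| · h((0 1) g)⁻²` on `GL_2` — on a
  unitary group `|det g|_𝔸 = 1` and we take the square root).
* PROVED: `lastRow (u g) = lastRow g` for `u ∈ N(𝔸_F)` (`borelHeight_unipotent_mul`);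
  `lastRow (b g) = b_{NN} · lastRow g` and `borelHeight (b g) = ‖b_{NN}‖_𝔸⁻¹ · borelHeight g` for
  `b ∈ B(𝔸_F)` (`borelHeight_borel_mul`); on the torus `t = diag(d)` (`c(d_{N-1}) d₀ = 1`):
  `borelHeight (t g) = ‖d₀‖_{𝔸_E} · borelHeight g` (`borelHeight_torus_mul'`, using the
  `Gal(E/F)`-invariance of the idele norm `ideleNorm_galSmul`; for `U(3)`, `t = d(a, b, ā⁻¹)`, the
  factor is `‖a‖_{𝔸_E}`); invariance under the rational Borel `B(F)` (`borelHeight_rational_borel_mul`,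
  product formula); `borelHeight (g k) = borelHeight g` whenever `k` preserves heights of row vectors.
  So `log ∘ borelHeight` is a positive multiple of Arthur's `H(g) = H_{P₀}(g) ∈ 𝔞₀ ≅ ℝ` of
  Rogawski (1990), §2.2 (`g = a m n k`, `H_P(g) = log a`), and `T < borelHeight g` is his cut-off
  `τ̂_P(H(g) − T)`; the companion file `UnitaryGroupBorelTruncation` builds the truncation on it.

## References

* P. Garrett, *Modern Analysis of Automorphic Forms by Example* (2018), §2.2 [Garrett2018].
* R. Godement, *Domaines fondamentaux des groupes arithmétiques*, Sém. Bourbaki 257 (1962/63), §1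
  [Godement1964].
* J. D. Rogawski, *Automorphic Representations of Unitary Groups in Three Variables* (1990), §2.2
  [Rogawski1990].
-/

noncomputable section

open MeasureTheory NumberField IsDedekindDomain Matrix
open scoped MatrixGroups NNReal

namespace Literature.NumberTheory.Automorphic

namespace UnitaryGroup

variable {F E : Type} [Field F] [NumberField F] [Field E] [NumberField E] [Algebra F E]
  {c : E ≃ₐ[F] E} {N : ℕ}

/-! ## The last row and the Borel height -/

section Height

variable [NeZero N]

/-- **The last row `e_N · g ∈ 𝔸_E^N`** of the matrix of `g ∈ U(J_N)(𝔸_F) ≤ GL_N(𝔸_E)` (row vectors,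
`GL_N` acting on the right as in Godement's and Garrett's height formalism). [cite: Garrett2018, §2.2 (PDF p. 83)] -/
def lastRow (g : (quasiSplit F E c N).Adelic) : Fin N → AdeleRing (𝓞 E) E :=
  (adelicVal F E c N _ g : Matrix (Fin N) (Fin N) (AdeleRing (𝓞 E) E)) ⊤

/-- Entries of the last row (definitional). [cite: Garrett2018, §2.2 (PDF p. 83)] -/
theorem lastRow_apply (g : (quasiSplit F E c N).Adelic) (j : Fin N) :
    lastRow g j = (adelicVal F E c N _ g : Matrix (Fin N) (Fin N) (AdeleRing (𝓞 E) E)) ⊤ j := rfl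

/-- `lastRow g = e_N ᵥ* g`. [cite: Garrett2018, §2.2 (PDF p. 83)] -/
theorem lastRow_eq_single_vecMul (g : (quasiSplit F E c N).Adelic) :
    lastRow g = Pi.single (⊤ : Fin N) (1 : AdeleRing (𝓞 E) E) ᵥ*
      (adelicVal F E c N _ g : Matrix (Fin N) (Fin N) (AdeleRing (𝓞 E) E)) := by
  rw [Matrix.single_one_vecMul]; rfl

/-- `lastRow g = ξ ᵥ* g` for the rational vector `ξ = e_N ∈ E^N` (`principalVec`). [cite: Garrett2018, §2.2 (PDF p. 83)] -/
theorem lastRow_eq_principalVec_vecMul (g : (quasiSplit F E c N).Adelic) :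
    lastRow g = principalVec E (Pi.single (⊤ : Fin N) (1 : E)) ᵥ*
      (adelicVal F E c N _ g : Matrix (Fin N) (Fin N) (AdeleRing (𝓞 E) E)) := by
  have h : principalVec E (Pi.single (⊤ : Fin N) (1 : E)) =
      Pi.single (⊤ : Fin N) (1 : AdeleRing (𝓞 E) E) := by
    funext i
    rw [principalVec_apply]
    by_cases hi : i = ⊤
    · subst hi; rw [Pi.single_eq_same, Pi.single_eq_same, map_one]
    · rw [Pi.single_eq_of_ne hi, Pi.single_eq_of_ne hi, map_zero]
  rw [h, lastRow_eq_single_vecMul]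

/-- The last row of `g` has finite height data (it is `ξ g` for the primitive rational vector
`ξ = e_N`). [cite: Garrett2018, §2.2 (PDF p. 82)] -/
theorem isHeightFinite_lastRow (g : (quasiSplit F E c N).Adelic) : IsHeightFinite E (lastRow g) := by
  classical
  rw [lastRow_eq_principalVec_vecMul]
  refine isHeightFinite_principalVec_vecMul (fun h => ?_) _
  have := congrFun h ⊤
  rw [Pi.single_eq_same, Pi.zero_apply] at this
  exact one_ne_zero this

/-- `lastRow (g h) = lastRow g ᵥ* h`. [cite: Garrett2018, §2.2 (PDF p. 83)] -/
theorem lastRow_mul (g h : (quasiSplit F E c N).Adelic) :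
    lastRow (g * h) = lastRow g ᵥ* (adelicVal F E c N _ h : Matrix (Fin N) (Fin N) (AdeleRing (𝓞 E) E)) := by
  funext j
  rw [lastRow_apply, map_mul, Units.val_mul, Matrix.mul_apply, Matrix.vecMul, dotProduct]
  rfl

/-- **The last row of an element of `B(𝔸_F)` is `b_{NN} e_N`.** [cite: Garrett2018, §2.2 (PDF p. 83)] -/
theorem lastRow_of_mem_borelAdelic {b : (quasiSplit F E c N).Adelic} (hb : b ∈ borelAdelic F E c N) :
    lastRow b = Pi.single (⊤ : Fin N)
      ((adelicVal F E c N _ b : Matrix (Fin N) (Fin N) (AdeleRing (𝓞 E) E)) ⊤ ⊤) := by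
  funext j
  by_cases hj : j = ⊤
  · subst hj; rw [Pi.single_eq_same, lastRow_apply]
  · rw [Pi.single_eq_of_ne hj, lastRow_apply]
    exact (mem_borelAdelic_iff b).1 hb (lt_top_iff_ne_top.2 hj)

/-- The last row of an element of `N(𝔸_F)` is `e_N`. [cite: Garrett2018, §2.2 (PDF p. 83)] -/
theorem lastRow_of_mem_adelicUnipotent {u : (quasiSplit F E c N).Adelic} (hu : u ∈ adelicUnipotent F E c N) :
    lastRow u = Pi.single (⊤ : Fin N) (1 : AdeleRing (𝓞 E) E) := by
  obtain ⟨-, hdiag⟩ := (mem_upperUnitriangular_iff _).1 ((mem_adelicUnipotent_iff u).1 hu)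
  rw [lastRow_of_mem_borelAdelic (adelicUnipotent_le_borelAdelic hu), hdiag]

/-- **`N(𝔸_F)`-invariance of the last row**: `lastRow (u g) = lastRow g` for `u ∈ N(𝔸_F)`.
[cite: Garrett2018, §2.2 (PDF p. 83)] -/
theorem lastRow_unipotent_mul {u : (quasiSplit F E c N).Adelic} (hu : u ∈ adelicUnipotent F E c N)
    (g : (quasiSplit F E c N).Adelic) : lastRow (u * g) = lastRow g := by
  rw [lastRow_mul, lastRow_of_mem_adelicUnipotent hu, Matrix.single_one_vecMul]; rfl

/-- **`B(𝔸_F)`-equivariance of the last row**: `lastRow (b g) = b_{NN} · lastRow g` for `b ∈ B(𝔸_F)`.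
[cite: Garrett2018, §2.2 (PDF p. 83)] -/
theorem lastRow_borel_mul {b : (quasiSplit F E c N).Adelic} (hb : b ∈ borelAdelic F E c N)
    (g : (quasiSplit F E c N).Adelic) :
    lastRow (b * g) = ((adelicVal F E c N _ b : Matrix (Fin N) (Fin N) (AdeleRing (𝓞 E) E)) ⊤ ⊤) •
      lastRow g := by
  rw [lastRow_mul, lastRow_of_mem_borelAdelic hb, Matrix.single_vecMul]; rfl

/-- The last diagonal entry of `b ∈ B(𝔸_F)` as an idele (its inverse is the last diagonal entry of
`b⁻¹ ∈ B(𝔸_F)`). [cite: Garrett2018, §2.2 (PDF p. 83)] -/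
def lastEntryUnit {b : (quasiSplit F E c N).Adelic} (hb : b ∈ borelAdelic F E c N) : (AdeleRing (𝓞 E) E)ˣ where
  val := (adelicVal F E c N _ b : Matrix (Fin N) (Fin N) (AdeleRing (𝓞 E) E)) ⊤ ⊤
  inv := (adelicVal F E c N _ b⁻¹ : Matrix (Fin N) (Fin N) (AdeleRing (𝓞 E) E)) ⊤ ⊤
  val_inv := by
    have h := congrFun (lastRow_borel_mul hb b⁻¹) ⊤
    rw [mul_inv_cancel, Pi.smul_apply, smul_eq_mul, lastRow_apply, lastRow_apply, map_one,
      Units.val_one, Matrix.one_apply_eq] at h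
    exact h.symm
  inv_val := by
    have h := congrFun (lastRow_borel_mul (Subgroup.inv_mem _ hb) b) ⊤
    rw [inv_mul_cancel, Pi.smul_apply, smul_eq_mul, lastRow_apply, lastRow_apply, map_one,
      Units.val_one, Matrix.one_apply_eq] at h
    exact h.symm

/-- `lastEntryUnit hb = b_{NN}` (definitional). [cite: Garrett2018, §2.2 (PDF p. 83)] -/
@[simp] theorem coe_lastEntryUnit {b : (quasiSplit F E c N).Adelic} (hb : b ∈ borelAdelic F E c N) :
    (lastEntryUnit hb : AdeleRing (𝓞 E) E) =
      (adelicVal F E c N _ b : Matrix (Fin N) (Fin N) (AdeleRing (𝓞 E) E)) ⊤ ⊤ := rfl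

/-- For a torus element `t = diag(d)` the last entry is `d_{N-1}`. [cite: Garrett2018, §2.2 (PDF p. 83)] -/
theorem coe_lastEntryUnit_of_glDiagonal_eq {t : (quasiSplit F E c N).Adelic} {d : Fin N → (AdeleRing (𝓞 E) E)ˣ}
    (hd : glDiagonal N (AdeleRing (𝓞 E) E) d = adelicVal F E c N _ t) :
    (lastEntryUnit (torusAdelic_le_borelAdelic ⟨d, hd⟩) : AdeleRing (𝓞 E) E) = d ⊤ := by
  rw [coe_lastEntryUnit, ← hd, coe_glDiagonal, Matrix.diagonal_apply_eq]

/-- **The Borel height** `borelHeight g = h(e_N · g)⁻¹ ∈ ℝ≥0` of `g ∈ U(J_N)(𝔸_F)`, `h = vecHeight`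
the height of adelic row vectors (Godement, Sém. Bourbaki 257, §1; Garrett (2018), §2.2:
`η(g) = |det g| · h((0 1) g)⁻²` on `GL_2(𝔸)`; on a unitary group `|det g|_𝔸 = 1` and we take the
square root). For `g = u · diag(d) · k` with `u ∈ N(𝔸_F)`, `k` height-preserving:
`borelHeight g = ‖d_{N-1}‖_𝔸⁻¹ = ‖d₀‖_{𝔸_E}` (`d_{N-1} = c(d₀)⁻¹` on `T(𝔸_F)`); for `U(3)`,
`t = d(a, b, ā⁻¹)`: `‖a‖_{𝔸_E}`. Up to the positive reparametrisation `exp ∘ (positive multiple)` this is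
Arthur's `H(g) = H_{P₀}(g)` of Rogawski (1990), §2.2 (`g = a m n k`, `H_P(g) = log a`), and
`T < borelHeight g` is the cut-off `τ̂_P(H(g) − T)`. [cite: Garrett2018, §2.2 (PDF p. 83)] -/
def borelHeight (g : (quasiSplit F E c N).Adelic) : ℝ≥0 := (vecHeight E (lastRow g))⁻¹

/-- Unfolding `borelHeight`. [cite: Garrett2018, §2.2 (PDF p. 83)] -/
theorem borelHeight_def (g : (quasiSplit F E c N).Adelic) :
    borelHeight g = (vecHeight E (lastRow g))⁻¹ := rfl

/-- **`N(𝔸_F)`-invariance of the Borel height**: `H(u g) = H(g)`. [cite: Garrett2018, §2.2 (PDF p. 83)] -/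
theorem borelHeight_unipotent_mul {u : (quasiSplit F E c N).Adelic} (hu : u ∈ adelicUnipotent F E c N)
    (g : (quasiSplit F E c N).Adelic) : borelHeight (u * g) = borelHeight g := by
  rw [borelHeight_def, borelHeight_def, lastRow_unipotent_mul hu]

/-- **`B(𝔸_F)`-equivariance of the Borel height**: `H(b g) = ‖b_{NN}‖_𝔸⁻¹ · H(g)` for `b ∈ B(𝔸_F)`
(Garrett (2018), §2.2: `η(p g) = |a/d| · η(g)`). [cite: Garrett2018, §2.2 (PDF p. 83)] -/
theorem borelHeight_borel_mul {b : (quasiSplit F E c N).Adelic} (hb : b ∈ borelAdelic F E c N)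
    (g : (quasiSplit F E c N).Adelic) :
    borelHeight (b * g) = (IdeleClassGroup.ideleNorm E (lastEntryUnit hb))⁻¹ * borelHeight g := by
  rw [borelHeight_def, borelHeight_def, lastRow_borel_mul hb, ← coe_lastEntryUnit hb,
    vecHeight_smul (isHeightFinite_lastRow g), mul_inv]

/-- On the torus: `borelHeight (t g) = ‖d_{N-1}‖_𝔸⁻¹ · borelHeight g` for `t = diag(d) ∈ T(𝔸_F)`.
[cite: Garrett2018, §2.2 (PDF p. 83)] -/
theorem borelHeight_torus_mul {t : (quasiSplit F E c N).Adelic} {d : Fin N → (AdeleRing (𝓞 E) E)ˣ}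
    (hd : glDiagonal N (AdeleRing (𝓞 E) E) d = adelicVal F E c N _ t) (g : (quasiSplit F E c N).Adelic) :
    borelHeight (t * g) = (IdeleClassGroup.ideleNorm E (d ⊤))⁻¹ * borelHeight g := by
  rw [borelHeight_borel_mul (torusAdelic_le_borelAdelic ⟨d, hd⟩)]
  congr 3
  exact Units.ext (coe_lastEntryUnit_of_glDiagonal_eq hd)

/-- **Invariance under the rational Borel `B(F)`** (product formula): `H(γ g) = H(g)` for `γ ∈ G(F)`
upper triangular. [cite: Garrett2018, §2.2 (PDF p. 83)] -/
theorem borelHeight_rational_borel_mul (γ : (quasiSplit F E c N).Rational)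
    (hγ : (quasiSplit F E c N).toAdelic γ ∈ borelAdelic F E c N) (g : (quasiSplit F E c N).Adelic) :
    borelHeight ((quasiSplit F E c N).toAdelic γ * g) = borelHeight g := by
  -- the last diagonal entry of `γ` is a non-zero element of `E`
  set a : E := (((show ↥(rational F E c N ((StdForm.antidiagonal N).over E)) from γ) : GL (Fin N) E) :
    Matrix (Fin N) (Fin N) E) ⊤ ⊤ with ha
  have hentry : (adelicVal F E c N _ ((quasiSplit F E c N).toAdelic γ) :
      Matrix (Fin N) (Fin N) (AdeleRing (𝓞 E) E)) ⊤ ⊤ = algebraMap E (AdeleRing (𝓞 E) E) a := rfl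
  haveI : Nontrivial (AdeleRing (𝓞 E) E) :=
    inferInstanceAs (Nontrivial (InfiniteAdeleRing E × FiniteAdeleRing (𝓞 E) E))
  have ha0 : a ≠ 0 := by
    intro h0
    have hu := (lastEntryUnit hγ).isUnit
    rw [coe_lastEntryUnit, hentry, h0, map_zero] at hu
    exact not_isUnit_zero hu
  rw [borelHeight_def, borelHeight_def, lastRow_borel_mul hγ, hentry,
    show algebraMap E (AdeleRing (𝓞 E) E) a = algebraMap E (AdeleRing (𝓞 E) E) (Units.mk0 a ha0 : Eˣ) from rfl,
    vecHeight_smul_algebraMap (isHeightFinite_lastRow g)]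

/-- **Right invariance under height-preserving elements**: if `k` preserves the heights of adelic
row vectors (e.g. `k` in the standard maximal compact subgroup), then `H(g k) = H(g)`.
[cite: Garrett2018, §2.2 (PDF p. 81)] -/
theorem borelHeight_mul_of_forall_vecHeight_vecMul_eq {k : (quasiSplit F E c N).Adelic}
    (hk : ∀ x : Fin N → AdeleRing (𝓞 E) E,
      vecHeight E (x ᵥ* (adelicVal F E c N _ k : Matrix (Fin N) (Fin N) (AdeleRing (𝓞 E) E))) = vecHeight E x)
    (g : (quasiSplit F E c N).Adelic) : borelHeight (g * k) = borelHeight g := by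
  rw [borelHeight_def, borelHeight_def, lastRow_mul, hk]

omit [NumberField F] in
/-- The idele norm is invariant under `Aut(E/F)`: `‖σ • a‖_𝔸 = ‖a‖_𝔸` (from the Galois invariance
of vector heights, `vecHeight_galSmul`, on the one-coordinate vector `(a)`; Godement, Sém.
Bourbaki 257, §1.1). [cite: Godement1964, §1.1] -/
theorem ideleNorm_galSmul (σ : E ≃ₐ[F] E) (a : (AdeleRing (𝓞 E) E)ˣ) :
    IdeleClassGroup.ideleNorm E
        (Units.map (MulSemiringAction.toRingHom (E ≃ₐ[F] E) (AdeleRing (𝓞 E) E) σ : _ →* _) a) =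
      IdeleClassGroup.ideleNorm E a := by
  classical
  rw [← vecHeight_single (K := E) (0 : Fin 1), ← vecHeight_single (K := E) (0 : Fin 1),
    ← vecHeight_galSmul σ (Pi.single (0 : Fin 1) (a : AdeleRing (𝓞 E) E))]
  congr 1
  funext i
  rw [galSmul_apply, Units.coe_map, MonoidHom.coe_coe, MulSemiringAction.toRingHom_apply]
  by_cases hi : i = 0
  · subst hi; rw [Pi.single_eq_same, Pi.single_eq_same]
  · rw [Pi.single_eq_of_ne hi, Pi.single_eq_of_ne hi, smul_zero]

/-- **Torus law in the first coordinate**: for `t = diag(d) ∈ T(𝔸_F)` (so `c(d_{N-1}) · d₀ = 1`),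
`borelHeight (t g) = ‖d₀‖_{𝔸_E} · borelHeight g` (for `U(3)`, `t = d(a, b, ā⁻¹)`: the factor
`‖a‖_{𝔸_E}`; Rogawski (1990), §2.2: `H(a m n k) = log a`). [cite: Rogawski1990, §2.2] -/
theorem borelHeight_torus_mul' {t : (quasiSplit F E c N).Adelic} {d : Fin N → (AdeleRing (𝓞 E) E)ˣ}
    (hd : glDiagonal N (AdeleRing (𝓞 E) E) d = adelicVal F E c N _ t) (g : (quasiSplit F E c N).Adelic) :
    borelHeight (t * g) = IdeleClassGroup.ideleNorm E (d 0) * borelHeight g := by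
  rw [borelHeight_torus_mul hd]
  congr 1
  -- `c(d ⊤) * d 0 = 1` on the torus (`⊤ = rev 0`)
  have hrel : ∀ i, conjAdele F E c (d (Fin.rev i) : AdeleRing (𝓞 E) E) * (d i : AdeleRing (𝓞 E) E) = 1 := by
    have h := adelicVal_mem_unitaryGroupOfForm t
    rw [← hd] at h
    exact (glDiagonal_mem_unitaryGroupOfForm_antidiagonal_iff _ N d).1 h
  have h0 := hrel 0
  rw [Fin.rev_zero_eq_top] at h0
  have hunit : (Units.map (MulSemiringAction.toRingHom (E ≃ₐ[F] E) (AdeleRing (𝓞 E) E) c : _ →* _) (d ⊤)) *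
      d 0 = 1 := by
    ext
    rw [Units.val_mul, Units.coe_map, MonoidHom.coe_coe, MulSemiringAction.toRingHom_apply, Units.val_one,
      ← conjAdele_apply]
    exact h0
  apply inv_eq_of_mul_eq_one_right
  rw [← ideleNorm_galSmul c (d ⊤), ← map_mul, hunit, map_one]

end Height

end UnitaryGroup

end Literature.NumberTheory.Automorphic
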